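import Mathlib.Analysis.Calculus.IteratedDeriv.Defs
import Mathlib.Analysis.Calculus.ContDiff.Defs
import Mathlib.Analysis.Complex.Basic
import Mathlib.MeasureTheory.Integral.Bochner.Basic
import Mathlib.MeasureTheory.Measure.Lebesgue.Basic
import Mathlib.Algebra.Polynomial.Degree.Defs
import Mathlib.Topology.Algebra.Support
import HarnessLib

/-!
# Functions with finitely many negative squares on `ℝ` are definitizable (Kreĭn 1959, Stewart 1972)

Topic `Literature/Analysis/OperatorTheory` (indefinite inner product spaces / Pontryagin spaces `Π_k`).
Cite item `wi-28847` (route RiemannHypothesis/RuelleBand, crux `CofiniteCriticalLine` =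
stmt-RiemannHypothesis-2064, line cofinite-weil-index-staircase: the "indefinite step" of the
registered stub `stub_definitize`).

A function `f : ℝ → ℂ` with `f(−x) = conj f(x)` **has `k` negative squares** (Kreĭn) if every
Hermitian form `Σᵢⱼ f(xᵢ − xⱼ) ξᵢ ξ̄ⱼ` has at most `k` negative squares, with equality for some
choice of the points; `k = 0` is Bochner's positive-definiteness.

* `HasAtMostNegSquares k f` — DEFINITION: every form `Σᵢⱼ f(xᵢ − xⱼ) ξᵢ ξ̄ⱼ` has at most `k`
  negative squares, in the subspace-free spelling "among any `k + 1` coefficient vectors some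
  non-trivial linear combination has non-negative form value" (so `f` has EXACTLY `j` negative
  squares for some `j ≤ k`); `HasAtMostNegSquares.of_nonneg` (positive semi-definite ⟹ any `k`).
* `Krein1959_definitizable` — NAMED FACT (Stewart 1972, Thm. 3.1 with Thm. 2.4; not proved here):
  a continuous Hermitian-symmetric `f` with at most `k` negative squares is DEFINITIZABLE by a
  differential operator of order `≤ k`: there is a polynomial `Q ≠ 0`, `deg Q ≤ k`, with
  `∫∫ f(x − y) (Q(−i d/dx)φ)(x) conj((Q(−i d/dy)φ)(y)) dx dy ≥ 0` for every `φ ∈ C_c^∞(ℝ)`.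

## What is printed

Stewart 1972 (Canad. Math. Bull. 15), §3, p. 403, **Theorem 3.1**: *If `f ∈ P_k(C_c^∞)` then there
is a polynomial `Q` of degree at most `k` such that
(4) `∫∫ f(x−y) Q(−i d/dx)φ(x) conj[Q(−i d/dy)φ(y)] dx dy ≥ 0` holds for every `φ ∈ C_c^∞`.*
Here `P_k(F)` (§2, p. 400) is the class of locally summable `f` with `f(x⁻¹) = conj f(x)` for which
the form (3) `∫∫ f(y⁻¹x) φ(x) conj ψ(y) dx dy` on `F` has at most `k` negative squares for every
choice of `n` and `φ₁, …, φₙ ∈ F`, and exactly `k` for some; §3, p. 403: `P_k(C_c^∞) = P_k(C_c)`;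
**Theorem 2.4** (p. 402): *a continuous function `f` has `k` negative squares if and only if it is
in `P_k(C_c)`.* PROOF of 3.1 (pp. 403–404): the form (5) makes `C_c^∞/H` a pre-`Π_k`-space
(Iohvidov–Kreĭn axioms); `A φ = i dφ/dx` is symmetric; Naĭmark's self-adjoint extension of the
second kind `A'` on `Π'_k ⊇ Π_k`; Pontryagin's theorem gives a `k`-dimensional `A'`-invariant
non-positive subspace `L`; `Q` := the minimal polynomial of `A'|_L` (so `Q ≠ 0`, `deg Q ≤ k`);
`Q(A')x ⊥ L` for all `x`, the orthogonal companion of `L` is non-negative, whence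
`(Q(A)φ, Q(A)φ) ≥ 0`, which is (4). Stewart then shows (p. 405) that the distribution
`Q(i d/dx) Q̄(i d/dx) f` is positive definite, hence (Bochner–Schwartz) the Fourier transform of a
positive tempered measure — recovering Kreĭn's integral representation (Kreĭn 1959, Dokl. 125,
quoted ibid. p. 399 as (2): `f(x) = h_p(x) + ∫ (e^{iλx} − S_p(x, λ))/|Q(λ)|² dσ(λ)`,
`Q(−i d/dx) Q̄(−i d/dx) h_p = 0`, `deg Q = k`). We vendor (4) — the definitization — for
CONTINUOUS `f` with at most `k` negative squares in Kreĭn's pointwise sense (Thm. 2.4 puts `f` in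
`P_j(C_c) = P_j(C_c^∞)` for the exact number `j ≤ k`, and Thm. 3.1 gives `deg Q ≤ j ≤ k`).

Remarks for users. (i) The double integral in (4) is a real number (`f` Hermitian-symmetric); we
state `0 ≤ re`. (ii) `(−i d/dx)^j φ = (−i)^j φ^{(j)}`, so `Q(−i d/dx)φ = Σⱼ Qⱼ (−i)^j φ^{(j)}`,
written below as a `Finset.range (natDegree Q + 1)` sum of `iteratedDeriv`s. (iii) For `f ∈ C^{2k}`,
integrating by parts in (4) gives the pointwise form: the kernel
`g := Σ_{a,b} Q_a conj(Q_b) (−i)^{a+b} (−1)^b f^{(a+b)}` (i.e. `Q(−iD) Q^*(−iD) f`,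
`Q^*(λ) = conj Q(conj λ)`, symbol `|Q(λ)|²` on `ℝ`) is an ordinary continuous positive-definite
function — this translation is NOT vendored (not printed as such); it is tree-side work for the
consumer. (iv) Background: Pontryagin 1944 (invariant non-positive subspaces in `Π_k`),
Iohvidov–Kreĭn 1956/59, Kreĭn–Langer 1977, Sasvári 1994 (definitizable functions).
-/

noncomputable section

open MeasureTheory
open scoped ComplexConjugate ContDiff BigOperators

namespace Literature.Analysis.OperatorTheory

/-- **At most `k` negative squares** (Kreĭn; Stewart 1972, §1 (1) and Thm. 2.4): for
`f : ℝ → ℂ`, every Hermitian form `ξ ↦ Σᵢⱼ f(xᵢ − xⱼ) ξᵢ conj ξⱼ` (`x₁, …, xₙ ∈ ℝ`) has at most `k`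
negative squares — spelled without subspaces: for any `k + 1` coefficient vectors
`c₀, …, c_k : Fin n → ℂ` some non-trivial combination `ξ = Σₘ aₘ cₘ` has non-negative form value
(if the `cₘ` are dependent a combination with `ξ = 0` works; otherwise this says their span is not
negative definite). `k = 0` is positive semi-definiteness of all the forms (Bochner).
[cite: Stewart1972, §1 (1), Thm 2.4] -/
def HasAtMostNegSquares (k : ℕ) (f : ℝ → ℂ) : Prop :=
  ∀ (n : ℕ) (x : Fin n → ℝ) (c : Fin (k + 1) → Fin n → ℂ),
    ∃ a : Fin (k + 1) → ℂ, a ≠ 0 ∧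
      0 ≤ (∑ i, ∑ j, f (x i - x j) * (∑ m, a m * c m i) * conj (∑ m, a m * c m j)).re

/-- A function all of whose forms `Σᵢⱼ f(xᵢ − xⱼ) ξᵢ conj ξⱼ` have non-negative real part (positive
semi-definite, `k = 0`) has at most `k` negative squares for every `k` (take `a = (1, 0, …, 0)`,
`ξ = c₀`). [folklore] -/
theorem HasAtMostNegSquares.of_nonneg {f : ℝ → ℂ}
    (hf : ∀ (n : ℕ) (x : Fin n → ℝ) (ξ : Fin n → ℂ),
      0 ≤ (∑ i, ∑ j, f (x i - x j) * ξ i * conj (ξ j)).re)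
    (k : ℕ) : HasAtMostNegSquares k f := by
  intro n x c
  refine ⟨Pi.single 0 1, ?_, ?_⟩
  · intro h
    have := congrFun h 0
    simp at this
  · have hξ : ∀ i, (∑ m, (Pi.single (0 : Fin (k + 1)) (1 : ℂ) : Fin (k + 1) → ℂ) m * c m i)
        = c 0 i := fun i => by
      rw [Finset.sum_eq_single (0 : Fin (k + 1))]
      · simp
      · intro m _ hm
        simp [hm]
      · intro h; exact absurd (Finset.mem_univ _) h
    simp_rw [hξ]
    exact hf n x (c 0)

/-- **Kreĭn 1959 / Stewart 1972, Thm. 3.1: functions with finitely many negative squares on `ℝ` are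
definitizable** (named fact, not proved here). Let `f : ℝ → ℂ` be continuous with
`f(−x) = conj f(x)` and at most `k` negative squares (`HasAtMostNegSquares k f`). Then there is a
polynomial `Q ≠ 0` with `deg Q ≤ k` such that for every `φ ∈ C_c^∞(ℝ, ℂ)`
`∫∫ f(x − y) (Q(−i d/dx)φ)(x) conj((Q(−i d/dy)φ)(y)) dx dy ≥ 0`,
where `Q(−i d/dx)φ = Σⱼ Qⱼ (−i)^j φ^{(j)}` — Stewart's (4) for `f ∈ P_j(C_c^∞)`, `j ≤ k` the exact
number of negative squares (Thm. 2.4 + `P_j(C_c) = P_j(C_c^∞)`, p. 403), `Q` the minimal polynomial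
of `A'|_L` in the proof (Pontryagin's invariant subspace), whence `Q ≠ 0`; Kreĭn 1959 proved the
finer integral representation (2) of which this is the definitization step.
[cite: Stewart1972, Thm 3.1 (p. 403) with Thm 2.4 (p. 402)] [cite: Krein1959, (2) as quoted in Stewart1972 p. 399] -/
def Krein1959_definitizable : Prop :=
  ∀ (k : ℕ) (f : ℝ → ℂ), Continuous f → (∀ x, f (-x) = conj (f x)) →
    HasAtMostNegSquares k f →
    ∃ Q : Polynomial ℂ, Q ≠ 0 ∧ Q.natDegree ≤ k ∧
      ∀ φ : ℝ → ℂ, ContDiff ℝ ∞ φ → HasCompactSupport φ →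
        0 ≤ (∫ x, ∫ y, f (x - y) *
              (∑ j ∈ Finset.range (Q.natDegree + 1),
                Q.coeff j * (-Complex.I) ^ j * iteratedDeriv j φ x) *
              conj (∑ j ∈ Finset.range (Q.natDegree + 1),
                Q.coeff j * (-Complex.I) ^ j * iteratedDeriv j φ y)).re

end Literature.Analysis.OperatorTheory
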